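import Literature.MathematicalPhysics.QuantumFieldTheory.Balaban1983to89.B12ContinuousTransportInvariance
import Literature.MathematicalPhysics.QuantumFieldTheory.Balaban1983to89.Node00.ContinuousTransportOfRecord
import Literature.MathematicalPhysics.QuantumFieldTheory.Balaban1983to89.T3OrbitAverage
import Literature.MathematicalPhysics.QuantumFieldTheory.Balaban1983to89.B12FaddeevPopov016TwoLevel
import Literature.MathematicalPhysics.QuantumFieldTheory.Balaban1983to89.T4WilsonResponseJunction
import Literature.MathematicalPhysics.QuantumFieldTheory.Balaban1983to89.B12CriticalPoint23

/-!
# NODE N09 · [Balaban1987RG1] p. 263 ∕ (2.16) p. 269 AT NODE 00's CONTINUOUS-VERSION TRANSPORT OF RECORD `TcOfRecord` with def-χ's fixed-threshold χ: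
# the (0.19) densities are INTEGRABLE (a theorem), their continuous transforms are gauge invariant EVERYWHERE, and N09's Theorem-3 member
# composition input `HCompT` holds modulo NODE 00's displayed proviso `HasContTransportAlong` and the [B11] inputs alone

T. Bałaban, *Renormalization group approach to lattice gauge field theories. I*, Commun. Math. Phys. **109** (1987) 249–301 [Balaban1987RG1] (= [I]);
[Balaban1985Variational] (= [B11], CMP 102) Thm 1 p. 279; [Balaban1985Averaging] (= [B7], CMP 98) (10) p. 19.  TRACK A (YM-PLAN §2b, node N09 of 28), seat
`pub-ymgap-dag-n09-a` (prover, KNIT-BY-NAME; HUMAN RULING D-0062), generation g4, MODULE 2.  THEOREMS ONLY, def-free, sorry-free, standard axioms.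
The INSTANTIATION of this seat's `B12ContinuousTransportInvariance` (MODULE 1: continuous `IsRT` images of lift-invariant densities are gauge invariant
everywhere; p. 263 over a transport with the mapping property at the densities met; `HCompT` ∕ (1.3) at the record ∕ the member plug) AT node00-def-T's
`Node00.ContinuousTransportOfRecord` (p423705: `TcOfRecord`, `HasContTransportAt`, `HasContTransportAlongβ`, `Stage8Params.HasContTransportAlong`,
`isRT_TcOfRecord`, `continuous_TcOfRecord` — consumed BY NAME) with def-χ's `chiFixed7` (`Node00.SmallFieldChiFixedOfRecord`, p421459).

CONTENT.
* §1 def-χ's β-slot χ `chiFixed7 ν K g k = χ({|V(∂p) − 1| < ε₀})` is GAUGE INVARIANT (`gaugeInvariant_chiFixed7`, `liftInvariant_chiFixed7`; MODULE 1's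
  `gaugeInvariant_chiSmall`), `[0,1]`-valued and measurable (def-χ), and COUPLING-BLIND, so the χ-locality input of node00-def-B's (0.23)-at-record is `rfl`
  (`chiFixed7_extd_prefixOf`).
* §2 SU(N) toolkit (the tree's compact metrisable Borel structure on `SU(N)^{bonds}`, `T3OrbitAverage`): a continuous real function on the configurations of one
  lattice is bounded, measurable and integrable for the product Haar probability (`exists_bound_of_continuous`, `integrable_of_continuous`); the gauge-fixing term
  of record is measurable and non-negative (`measurable_gfOfRecord` — Federbush's (0.10)∕(0.11) contour variables are measurable, `B12FaddeevPopov016TwoLevel.measurable_holTo`;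
  `gfOfRecord_nonneg` = `B12CriticalPoint23.gaugeFixFn_nonneg`); `abs_integrand_le` ∕ `measurable_integrand` (the (0.19) density `χ·exp[−GF/g² + A]` is bounded by
  any bound of `exp ∘ A` when `χ ∈ [0,1]`, `GF ≥ 0`, and measurable when its ingredients are).
* §3 **`integrable_integrand_of_continuousTransport`** — over ANY transport family whose images are CONTINUOUS functions and any measurable `[0,1]`-valued χ,
  EVERY (0.19) density `χ_k·exp[−GF_k/g_k² + A_k]` met along the sequence is INTEGRABLE: `A_0 = −(1/g_0²)A^η ≤ 0`; `exp A_{k+1} = exp∘log` of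
  `𝐍_k⁻¹·(T_k ρ_k)(·)`, and `exp (log x) ≤ |x| + 1` with `T_k ρ_k` bounded on the compact configuration space; hence **`integrable_integrand_TcOfRecord`** at
  `TcOfRecord` (whose images are continuous UNCONDITIONALLY, `continuous_TcOfRecord`) — node00-def-T's `isRT_TcOfRecord` never needs an integrability proviso
  along the β-layer; `integrable_TcOfRecord` (every image is integrable).
* §4 **`stepInvariant_TcOfRecord`** — THE PER-STEP MAPPING PROPERTY AT `TcOfRecord`: at a step `k < K` where the (0.19) density met has a continuous transform
  (`HasContTransportAt`, node00-def-T's displayed proviso), `TcOfRecord K k` sends it — if lift-invariant — to a function gauge invariant at EVERY coarse field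
  (MODULE 1's `stepInvariant_of_isRT_continuous` ∘ `isRT_TcOfRecord` ∘ §3); **`gaugeInvariant_effActionHT_TcOfRecord`** (p. 263 AT THE β RE-POINT OF RECORD: under
  `∀ k < K, HasContTransportAlongβ (TcOfRecord) ν K g k` every `A_k`, `k ≤ K`, built with `TcOfRecord` and `chiFixed7 ν` is gauge invariant), `hInvT_TcOfRecord`,
  **`hCompT_TcOfRecord`** (N09's composition input from `HRestrict` + intermediate (1.1)-uniqueness + the proviso), **`indAOfRecordT_atRecord_TcOfRecord`**
  (node00-def-B's (1.3)∕(0.23) at the record's objects over `TcOfRecord`∕`chiFixed7`: from the flow recursion, (1.1) on the domain, `HRestrict`, intermediate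
  uniqueness and the proviso — NO composition∕invariance hypothesis, NO χ-locality hypothesis), θ-level forms under `Stage8Params.HasContTransportAlong θ`.
* §5 **`thm3Member_of_indATPlug_TcOfRecord`** ∕ `b12_main_of_indATPlug_of_leaf_TcOfRecord` — for ANY binding world whose run flow is `genFlow β P.g₀` and whose
  `IndAss k` IS `IndAOfRecordT (TcOfRecord) (chiFixed7 ν) ε β …` at the record's objects (node00-def-T's announced `Record10`: `indAss_stage10_iff`, with
  `Provisos₁₀.contT : HasContTransportAlong`), the Theorem-3 member `smallCouplings → smallFieldInductive` — hence N09 given its leaf — from (1.1) on the domains,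
  `HRestrict`, intermediate uniqueness and `∀ k < K, HasContTransportAlongβ (TcOfRecord) ν K (genSeq β g₀) k`: [B11] Thm 1 at the record's objects + the record's
  OWN proviso; the MIDDLE composition clauses of (0.23) («unknowable» over the RN-version transport at Stages 8∕9, `B12NodeKnitRecord8` §6) are THEOREMS here.

HONEST FRAMING: count-neutral kernel bookkeeping; the EXISTENCE of continuous versions (`HasContTransportAt ∕ Along`) is NODE 00's DISPLAYED proviso (certified
inside `Record10`'s `Provisos`, never asserted here), (1.1)∕`HRestrict`∕uniqueness are [B11] Thm 1 at the record's objects (N07); nothing of Bałaban's asserted;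
no estimate; N09 NOT discharged; conjunct 1 (the B12-group pin) untouched; one finite T⁴ at fixed ε — NOT continuum ∕ ℝ⁴ ∕ OS ∕ mass gap ∕ Clay.
-/

noncomputable section

namespace Literature.MathematicalPhysics.QuantumFieldTheory.Balaban1983to89.B12NodeKnitContinuousTransport

open MeasureTheory
open DagBinding Node00 T4Continuum
open FlowStep (HBeta prefixOf RGEqH)
open FlowStepRuns (genSeq genFlow)
open T4FlagMemory (extd)
open B12Eq019ActionBody (integrand integrand_apply nextAction_apply)
open B12RTGaugeInvariance254 (LiftInvariant liftInvariant_of_gaugeInvariant)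
open GaugeField (GaugeInvariant gaugeAct)
open B12NodeKnitRecord8 (b12_main_of_leaf_of_thm3Member)
open B12ContinuousTransportInvariance (gaugeInvariant_chiSmall stepInvariant_of_isRT_continuous gaugeInvariant_effActionHT_of_steps hInvT_of_steps
  hCompT_of_steps indAOfRecordT_atRecord_of_steps thm3Member_of_indATPlug_of_steps)
open T3OrbitAverage

variable (F : T4Family) (N : ℕ) [NeZero N]

/-! ## §1. def-χ's fixed-threshold χ: gauge invariant, `[0,1]`-valued, coupling-blind -/

variable {F N}

/-- **THE β-SLOT χ OF RECORD IS GAUGE INVARIANT**: `chiFixed7 ν K g k = χ({|V(∂p) − 1| < ε₀, all p})` (def-χ's second printed form, p. 259) takes the same value at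
`V^u` and `V` (MODULE 1's `gaugeInvariant_chiSmall`: plaquette variables are conjugated, `dist1` is conjugation invariant). [cite: Balaban1987RG1, p.259 and (0.16) p.255] -/
theorem gaugeInvariant_chiFixed7 (ν : Stage7Numerics) (K : ℕ) (g : ℕ → ℝ) (k : ℕ) : GaugeInvariant (chiFixed7 F N ν K g k) :=
  gaugeInvariant_chiSmall (G := SU N) Set.univ ν.ε₀

/-- … hence lift-invariant (the form the (0.19) induction consumes). [cite: Balaban1987RG1, p.259 and (0.13) p.254] -/
theorem liftInvariant_chiFixed7 (ν : Stage7Numerics) (K : ℕ) (g : ℕ → ℝ) (k : ℕ) : LiftInvariant (chiFixed7 F N ν K g k) :=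
  liftInvariant_of_gaugeInvariant (gaugeInvariant_chiFixed7 ν K g k)

/-- `χ ≤ 1` (def-χ's `chiFixAltOfRecord_le_one`, re-keyed). [cite: Balaban1987RG1, p.259 (bookkeeping)] -/
theorem chiFixed7_le_one (ν : Stage7Numerics) (K : ℕ) (g : ℕ → ℝ) (k : ℕ) (V : GaugeField (F.P K) k (SU N)) : chiFixed7 F N ν K g k V ≤ 1 :=
  chiFixAltOfRecord_le_one ν K k V

/-- **χ-LOCALITY IS `rfl`**: the β-slot χ of record is coupling-blind, so the clamped history and the run give the same characteristic functions (node00-def-B's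
`hχ` input of `indAOfRecordT_atRecord`, discharged by typing). [cite: Balaban1987RG1, (0.26) p.257 (bookkeeping)] -/
theorem chiFixed7_extd_prefixOf (ν : Stage7Numerics) (K : ℕ) (g : ℕ → ℝ) (k : ℕ) :
    ∀ n ≤ k, chiFixed7 F N ν K (extd (prefixOf g k)) n = chiFixed7 F N ν K g n := fun _ _ => rfl

/-! ## §2. SU(N) toolkit: continuous ⇒ bounded ∕ measurable ∕ integrable; the gauge-fixing term of record; the (0.19) density -/

omit [NeZero N] in
/-- A continuous real function on the compact configuration space `SU(N)^{bonds}` of one lattice is BOUNDED. [cite: Balaban1985Averaging, (10) p.19 (bookkeeping)] -/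
theorem exists_bound_of_continuous {P : Params} {j : ℕ} {f : GaugeField P j (SU N) → ℝ} (hf : Continuous f) : ∃ C, ∀ U, |f U| ≤ C := by
  obtain ⟨C, hC⟩ := isCompact_univ.exists_bound_of_continuousOn hf.continuousOn
  exact ⟨C, fun U => by simpa [Real.norm_eq_abs] using hC U (Set.mem_univ U)⟩

/-- A bounded measurable real function is integrable for the product Haar PROBABILITY measure. [cite: Balaban1985Averaging, (10) p.19 (bookkeeping)] -/
theorem integrable_of_bounded_measurable {P : Params} {j : ℕ} {f : GaugeField P j (SU N) → ℝ} (hf : Measurable f) {C : ℝ} (hC : ∀ U, |f U| ≤ C) :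
    Integrable f (fieldMeasure P j (SU N)) :=
  Integrable.mono' (integrable_const C) hf.aestronglyMeasurable (Filter.Eventually.of_forall fun U => by simpa [Real.norm_eq_abs] using hC U)

/-- A continuous real function on `SU(N)^{bonds}` is integrable for product Haar measure (bounded + Borel measurable). [cite: Balaban1985Averaging, (10) p.19 (bookkeeping)] -/
theorem integrable_of_continuous {P : Params} {j : ℕ} {f : GaugeField P j (SU N) → ℝ} (hf : Continuous f) : Integrable f (fieldMeasure P j (SU N)) := by
  obtain ⟨C, hC⟩ := exists_bound_of_continuous hf
  exact integrable_of_bounded_measurable hf.measurable hC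

/-- **The gauge-fixing term of record `Σ_y Σ_{x∈B(y), x≠y} [1 − Re tr U(y,x)]` is MEASURABLE** — Federbush's averaged contour variables (0.10)∕(0.11) are measurable in
`U` (`B12FaddeevPopov016TwoLevel.measurable_holTo` at `FederbushMean.federbushSU_measurable`), `Re tr` is. [cite: Balaban1987RG1, (0.11) p.253 and (0.17) p.255] -/
theorem measurable_gfOfRecord (K k : ℕ) : Measurable (gfOfRecord F N K k) := by
  show Measurable fun U : GaugeField (F.P K) k (SU N) =>
    ∑ y ∈ Finset.univ, ∑ x ∈ (block y).erase (emb y), (1 - reTr ((contourOfRecord F N K k).holTo U y x))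
  refine Finset.measurable_sum _ fun y _ => Finset.measurable_sum _ fun x _ => ?_
  exact measurable_const.sub (RegularGaugeGroup.measurable_reTr.comp
    (B12FaddeevPopov016TwoLevel.measurable_holTo _ FederbushMean.federbushSU_measurable y x))

/-- The gauge-fixing term of record is non-negative (`B12CriticalPoint23.gaugeFixFn_nonneg`: each `1 − Re tr ≥ 0`). [cite: Balaban1987RG1, (0.17) p.255] -/
theorem gfOfRecord_nonneg (K k : ℕ) (U : GaugeField (F.P K) k (SU N)) : 0 ≤ gfOfRecord F N K k U :=
  B12CriticalPoint23.gaugeFixFn_nonneg _ _ U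

/-- `exp (log x) ≤ |x| + 1` (`= |x|` off `0`, `= 1` at `0`). [folklore] -/
private theorem exp_log_le (x : ℝ) : Real.exp (Real.log x) ≤ |x| + 1 := by
  by_cases hx : x = 0
  · rw [hx, Real.log_zero, Real.exp_zero]; simp
  · rw [Real.exp_log_eq_abs hx]; linarith [abs_nonneg x]

omit [NeZero N] in
/-- **BOUND OF THE (0.19) DENSITY**: for `χ ∈ [0,1]`, `GF ≥ 0` and `exp ∘ A ≤ B`, `|χ(U)·exp[−(1/g²)GF(U) + A(U)]| ≤ B` (the gauge-fixing exponent is `≤ 0`).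
[cite: Balaban1987RG1, (0.19) p.255] -/
theorem abs_integrand_le {P : Params} {k : ℕ} {χ GF A : Density P k (SU N)} (hχ0 : ∀ U, 0 ≤ χ U) (hχ1 : ∀ U, χ U ≤ 1) (hGF : ∀ U, 0 ≤ GF U)
    (gk : ℝ) {B : ℝ} (hA : ∀ U, Real.exp (A U) ≤ B) (U : GaugeField P k (SU N)) : |integrand χ GF gk A U| ≤ B := by
  rw [integrand_apply, abs_mul, abs_of_nonneg (hχ0 U), Real.abs_exp, Real.exp_add]
  have h1 : Real.exp (-(1 / gk ^ 2) * GF U) ≤ 1 := by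
    refine Real.exp_le_one_iff.2 ?_
    have : 0 ≤ 1 / gk ^ 2 * GF U := mul_nonneg (one_div_nonneg.2 (sq_nonneg _)) (hGF U)
    linarith
  calc χ U * (Real.exp (-(1 / gk ^ 2) * GF U) * Real.exp (A U))
      ≤ 1 * (1 * B) := by
        refine mul_le_mul (hχ1 U) (mul_le_mul h1 (hA U) (Real.exp_pos _).le zero_le_one) ?_ zero_le_one
        exact mul_nonneg (Real.exp_pos _).le (Real.exp_pos _).le
    _ = B := by ring

omit [NeZero N] in
/-- The (0.19) density is measurable when `χ`, `GF`, `A` are. [cite: Balaban1987RG1, (0.19) p.255 (bookkeeping)] -/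
theorem measurable_integrand {P : Params} {k : ℕ} {χ GF A : Density P k (SU N)} (hχ : Measurable χ) (hGF : Measurable GF) (hA : Measurable A) (gk : ℝ) :
    Measurable (integrand χ GF gk A) := by
  rw [B12Eq019ActionBody.integrand_eq]
  exact hχ.mul (Real.measurable_exp.comp ((measurable_const.mul hGF).add hA))

/-! ## §3. Every (0.19) density met is INTEGRABLE over a transport with continuous images — in particular over `TcOfRecord` -/

/-- **INTEGRABILITY OF EVERY (0.19) DENSITY MET over a transport family with CONTINUOUS images**, for measurable `[0,1]`-valued characteristic functions:
`χ_k·exp[−GF_k/g_k² + A_k]` is measurable and bounded — by `1` at `k = 0` (`A_0 = −(1/g_0²)A^η ≤ 0`, `wilsonAction4_nonneg`), by `|𝐍_k⁻¹|·C + 1` at `k + 1`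
where `|T K k ρ_k| ≤ C` on the compact configuration space (`A_{k+1} = log(𝐍_k⁻¹·(T K k ρ_k)(·))`, `exp (log x) ≤ |x| + 1`) — hence integrable for the
probability measure `dU`. [cite: Balaban1987RG1, (0.17)–(0.19) p.255] -/
theorem integrable_integrand_of_continuousTransport (T : Transport F N) (hT : ∀ K j (ρ : Density (F.P K) j (SU N)), Continuous (T K j ρ))
    (χ : (K : ℕ) → (ℕ → ℝ) → (k : ℕ) → Density (F.P K) k (SU N)) (hχm : ∀ K g k, Measurable (χ K g k))
    (hχ0 : ∀ K g k U, 0 ≤ χ K g k U) (hχ1 : ∀ K g k U, χ K g k U ≤ 1) (K : ℕ) (g : ℕ → ℝ) (k : ℕ) :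
    Integrable (integrand (χ K g k) (gfOfRecord F N K k) (g k) (effActionHT F N T χ K g k)) (fieldMeasure (F.P K) k (SU N)) := by
  cases k with
  | zero =>
    refine integrable_of_bounded_measurable
      (measurable_integrand (hχm K g 0) (measurable_gfOfRecord K 0) ?_ (g 0))
      (abs_integrand_le (hχ0 K g 0) (hχ1 K g 0) (gfOfRecord_nonneg K 0) (g 0) (B := 1) ?_)
    · rw [effActionHT_zero]
      exact T4WilsonResponseJunction.measurable_neg_mul_wilsonAction _ _
    · intro U
      rw [effActionHT_zero]
      refine Real.exp_le_one_iff.2 ?_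
      show -(1 / g 0 ^ 2) * wilsonAction 1 U ≤ 0
      have : 0 ≤ 1 / g 0 ^ 2 * wilsonAction 1 U := mul_nonneg (one_div_nonneg.2 (sq_nonneg _)) (wilsonAction4_nonneg U)
      linarith
  | succ j =>
    have hc : Continuous (T K j (integrand (χ K g j) (gfOfRecord F N K j) (g j) (effActionHT F N T χ K g j))) := hT K j _
    obtain ⟨C, hC⟩ := exists_bound_of_continuous hc
    refine integrable_of_bounded_measurable
      (measurable_integrand (hχm K g (j + 1)) (measurable_gfOfRecord K (j + 1)) ?_ (g (j + 1)))
      (abs_integrand_le (hχ0 K g (j + 1)) (hχ1 K g (j + 1)) (gfOfRecord_nonneg K (j + 1)) (g (j + 1))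
        (B := |(normConstHT F N T χ K g j)⁻¹| * C + 1) ?_)
    · rw [effActionHT_succ]
      show Measurable fun V => Real.log ((B12Eq019ActionBody.normConst (T K j) (χ K g j) (gfOfRecord F N K j) (g j)
        (effActionHT F N T χ K g j))⁻¹ * T K j (integrand (χ K g j) (gfOfRecord F N K j) (g j) (effActionHT F N T χ K g j)) V)
      exact Real.measurable_log.comp (measurable_const.mul hc.measurable)
    · intro V
      rw [effActionHT_succ, nextAction_apply]
      refine (exp_log_le _).trans ?_
      rw [abs_mul]
      have h := mul_le_mul_of_nonneg_left (hC V) (abs_nonneg ((normConstHT F N T χ K g j)⁻¹))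
      exact add_le_add h le_rfl

/-- node00-def-T's continuous-version transport has continuous images, read on the tree's `GaugeField` carrier (its `continuous_TcOfRecord` is stated on the raw
Pi carrier; same topology). [cite: Balaban1987RG1, (0.13) p.254 (bookkeeping)] -/
theorem continuous_TcOfRecord_gaugeField (K k : ℕ) (ρ : Density (F.P K) k (SU N)) : Continuous (TcOfRecord F N K k ρ) :=
  continuous_TcOfRecord K k ρ

/-- Every image of `TcOfRecord` is integrable (continuous on a compact space, probability measure). [cite: Balaban1987RG1, (0.13) p.254 (bookkeeping)] -/
theorem integrable_TcOfRecord (K k : ℕ) (ρ : Density (F.P K) k (SU N)) : Integrable (TcOfRecord F N K k ρ) (fieldMeasure (F.P K) (k + 1) (SU N)) :=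
  integrable_of_continuous (continuous_TcOfRecord_gaugeField K k ρ)

/-- **EVERY (0.19) DENSITY MET ALONG THE β-LAYER OF RECORD IS INTEGRABLE** — at `TcOfRecord` with def-χ's `chiFixed7 ν` (measurable, `[0,1]`-valued), every
torus, coupling sequence and step; so node00-def-T's `isRT_TcOfRecord` carries NO integrability proviso along the β-layer. [cite: Balaban1987RG1, (0.19) p.255] -/
theorem integrable_integrand_TcOfRecord (ν : Stage7Numerics) (K : ℕ) (g : ℕ → ℝ) (k : ℕ) :
    Integrable (integrand (chiFixed7 F N ν K g k) (gfOfRecord F N K k) (g k) (effActionHT F N (TcOfRecord F N) (chiFixed7 F N ν) K g k))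
      (fieldMeasure (F.P K) k (SU N)) :=
  integrable_integrand_of_continuousTransport (TcOfRecord F N) (fun K j ρ => continuous_TcOfRecord_gaugeField K j ρ) (chiFixed7 F N ν)
    (fun K g k => measurable_chiFixed7 F N ν K g k) (fun K g k U => chiFixed7_nonneg F N ν K g k U) (fun K g k U => chiFixed7_le_one ν K g k U) K g k

/-! ## §4. The per-step mapping property AT `TcOfRecord`, p. 263 at the β re-point of record, `HCompT` and (1.3) at the record -/

/-- **THE PER-STEP MAPPING PROPERTY AT `TcOfRecord`**: at a step `k < K` of the `K`-th torus where the (0.19) density met (built with `TcOfRecord` and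
`chiFixed7 ν`) has a CONTINUOUS transform of record (`HasContTransportAlongβ`, node00-def-T's displayed proviso), `TcOfRecord K k` sends that density — if
lift-invariant — to a function gauge invariant at EVERY coarse field: MODULE 1's `stepInvariant_of_isRT_continuous` with `isRT_TcOfRecord` (§3 supplies its
integrability input), `integrable_TcOfRecord`, `continuous_TcOfRecord`. [cite: Balaban1987RG1, (0.13) p.254 and (0.19) p.255] -/
theorem stepInvariant_TcOfRecord (ν : Stage7Numerics) (K : ℕ) (g : ℕ → ℝ) {k : ℕ} (hk : k < K)
    (hex : HasContTransportAlongβ F N (TcOfRecord F N) ν K g k) :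
    LiftInvariant (integrand (chiFixed7 F N ν K g k) (gfOfRecord F N K k) (g k) (effActionHT F N (TcOfRecord F N) (chiFixed7 F N ν) K g k)) →
      GaugeInvariant (TcOfRecord F N K k (integrand (chiFixed7 F N ν K g k) (gfOfRecord F N K k) (g k)
        (effActionHT F N (TcOfRecord F N) (chiFixed7 F N ν) K g k))) :=
  stepInvariant_of_isRT_continuous (TcOfRecord F N) (chiFixed7 F N ν) K g
    ((Nat.succ_le_of_lt hk).trans (Nat.le_add_left _ _))
    (isRT_TcOfRecord hk (integrable_integrand_TcOfRecord ν K g k) hex) (integrable_TcOfRecord K k _) (continuous_TcOfRecord_gaugeField K k _)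

/-- **THE EFFECTIVE ACTIONS AT THE β RE-POINT OF RECORD ARE GAUGE INVARIANT (p. 263 as a theorem)**: on the `K`-th torus, if the (0.19) densities met at the
steps `k < K` have continuous transforms of record, then every `A_k = effActionHT (TcOfRecord) (chiFixed7 ν) K g k`, `k ≤ K`, satisfies `A_k(V^v) = A_k(V)` for
ALL `v`, `V` (MODULE 1's induction; χ lift-invariant by §1). [cite: Balaban1987RG1, p.263 («the action A_k(U) … is gauge invariant») and (2.16) p.269] -/
theorem gaugeInvariant_effActionHT_TcOfRecord (ν : Stage7Numerics) (K : ℕ) (g : ℕ → ℝ)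
    (hex : ∀ k < K, HasContTransportAlongβ F N (TcOfRecord F N) ν K g k) :
    ∀ k ≤ K, GaugeInvariant (effActionHT F N (TcOfRecord F N) (chiFixed7 F N ν) K g k) :=
  gaugeInvariant_effActionHT_of_steps (TcOfRecord F N) (chiFixed7 F N ν) K g (Nat.le_add_left _ _) (fun k _ => liftInvariant_chiFixed7 ν K g k)
    fun k hk => stepInvariant_TcOfRecord ν K g hk (hex k hk)

/-- **`HInvT` AT THE β RE-POINT OF RECORD**, every level `k ≤ K`: the residual-gauge invariance of `A_j ∘ Ū^j`, `j < k` ([I] (0.21) ∕ (2.16)) — a THEOREM modulo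
the continuity proviso. [cite: Balaban1987RG1, (0.21) p.256 and (2.16) p.269] -/
theorem hInvT_TcOfRecord (ν : Stage7Numerics) (K : ℕ) (g : ℕ → ℝ) (hex : ∀ k < K, HasContTransportAlongβ F N (TcOfRecord F N) ν K g k) {k : ℕ}
    (hk : k ≤ K) : HInvT F N (TcOfRecord F N) (chiFixed7 F N ν) K g k :=
  hInvT_of_steps (TcOfRecord F N) (chiFixed7 F N ν) K g (Nat.le_add_left _ _) (fun k _ => liftInvariant_chiFixed7 ν K g k)
    (fun k hk => stepInvariant_TcOfRecord ν K g hk (hex k hk)) hk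

/-- **N09's COMPOSITION INPUT `HCompT` AT THE β RE-POINT OF RECORD** (level `k ≤ K`, domain `dom`, background radius `ε`): from `HRestrict` ([B11] Thm 1 (8)–(10))
+ (1.1)-uniqueness at the intermediate levels + the continuity proviso at the steps `< K` — the MIDDLE composition clauses of (0.23) are theorems over
`TcOfRecord`. [cite: Balaban1987RG1, (0.21)–(0.23) p.256, (1.1) p.260 and (2.16) p.269; Balaban1985Variational, Thm 1 (8)–(10) p.279] -/
theorem hCompT_TcOfRecord (ν : Stage7Numerics) {ε : ℝ} (K : ℕ) (g : ℕ → ℝ) (hex : ∀ k < K, HasContTransportAlongβ F N (TcOfRecord F N) ν K g k)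
    {k : ℕ} (hk : k ≤ K) {dom : Set (GaugeField (F.P K) k (SU N))} (hres : HRestrict F N ε K k dom)
    (huniq : ∀ V ∈ dom, ∀ j < k, UniqueUkOrbit F N K (j + 1) ε (Averaging.iter (avOfRecord F N K) (j + 1) (Uk F N K k ε V))) :
    HCompT F N (TcOfRecord F N) (chiFixed7 F N ν) ε K g k dom :=
  hCompT_of_steps (TcOfRecord F N) (chiFixed7 F N ν) K g le_rfl (fun k _ => liftInvariant_chiFixed7 ν K g k)
    (fun k hk => stepInvariant_TcOfRecord ν K g hk (hex k hk)) hk hres huniq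

/-- **(1.3)∕(0.23) AT THE RECORD OVER `TcOfRecord` ∕ `chiFixed7`, COMPOSITION INPUT DISCHARGED**: node00-def-B's `IndAOfRecordT` at the record's own history,
domain, action, background action and expansion term follows from the flow recursion (0.20) up to `k`, (1.1) on the domain, `HRestrict`, intermediate
uniqueness and the continuity proviso at the steps `< k` — χ-locality is `rfl` (§1), the per-step property is §4. [cite: Balaban1987RG1, (1.1)–(1.3) p.260, (0.22)–(0.23) p.256, p.263 and (2.16) p.269] -/
theorem indAOfRecordT_atRecord_TcOfRecord (ν : Stage7Numerics) (ε : ℝ) (β : HBeta) (p : B12.RunParams) (k : ℕ) (hk : k ≤ p.K)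
    (dom : Set (GaugeField (F.P p.K) k (SU N)))
    (hex : ∀ j < k, HasContTransportAlongβ F N (TcOfRecord F N) ν p.K (genSeq β p.g0) j)
    (hflow : RGEqH k β (genSeq β p.g0))
    (h11 : ∀ V ∈ dom, UkExists F N p.K k ε V ∧ UniqueUkOrbit F N p.K k ε V)
    (hres : HRestrict F N ε p.K k dom)
    (huniq : ∀ V ∈ dom, ∀ j < k, UniqueUkOrbit F N p.K (j + 1) ε (Averaging.iter (avOfRecord F N p.K) (j + 1) (Uk F N p.K k ε V))) :
    IndAOfRecordT F N (TcOfRecord F N) (chiFixed7 F N ν) ε β p k (prefixOf (genSeq β p.g0) k) dom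
      (effActionOfRecordT F N (TcOfRecord F N) (chiFixed7 F N ν) β p k) (wilsonBGOfRecord F N ε p k)
      (EkOfRecordT F N (TcOfRecord F N) (chiFixed7 F N ν) ε β p k) :=
  indAOfRecordT_atRecord_of_steps (TcOfRecord F N) (chiFixed7 F N ν) ε β p k hk dom (fun j _ => liftInvariant_chiFixed7 ν p.K _ j)
    (fun j hj => stepInvariant_TcOfRecord ν p.K (genSeq β p.g0) (hj.trans_le hk) (hex j hj))
    (chiFixed7_extd_prefixOf ν p.K (genSeq β p.g0) k) hflow h11 hres huniq

/-- θ-LEVEL FORM: under node00-def-T's proviso `Stage8Params.HasContTransportAlong θ` (announced inside `Record10`'s `Provisos₁₀` as `contT`), `HCompT` at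
`(TcOfRecord, chiFixed7 θ.ν)` holds at every torus, coupling sequence, level `k ≤ K` and domain from `HRestrict` + intermediate uniqueness alone.
[cite: Balaban1987RG1, (0.21)–(0.23) p.256 and (2.16) p.269; Balaban1985Variational, Thm 1 p.279] -/
theorem hCompT_TcOfRecord_of_hasContTransportAlong (θ : Stage8Params F N) (hθ : θ.HasContTransportAlong) {ε : ℝ} (K : ℕ) (g : ℕ → ℝ) {k : ℕ}
    (hk : k ≤ K) {dom : Set (GaugeField (F.P K) k (SU N))} (hres : HRestrict F N ε K k dom)
    (huniq : ∀ V ∈ dom, ∀ j < k, UniqueUkOrbit F N K (j + 1) ε (Averaging.iter (avOfRecord F N K) (j + 1) (Uk F N K k ε V))) :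
    HCompT F N (TcOfRecord F N) (chiFixed7 F N θ.ν) ε K g k dom :=
  hCompT_TcOfRecord θ.ν K g (fun k hk => hθ K g k hk) hk hres huniq

/-! ## §5. The Theorem-3 member at a binding world whose `IndAss` reads `TcOfRecord` ∕ `chiFixed7` (node00-def-T's `Record10` shape) -/

section Plug

variable {w : WorldP} {P : B12.RunParams} (ν : Stage7Numerics) (ε : ℝ) (β : HBeta) (dom : (k : ℕ) → Set (GaugeField (F.P P.K) k (SU N)))
  (hflow : (w.C P).flow = genFlow β P.g0)
  (hind : ∀ k, k ≤ P.K → ((w.C P).IndAss k ↔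
    IndAOfRecordT F N (TcOfRecord F N) (chiFixed7 F N ν) ε β P k (prefixOf (genSeq β P.g0) k) (dom k)
      (effActionOfRecordT F N (TcOfRecord F N) (chiFixed7 F N ν) β P k) (wilsonBGOfRecord F N ε P k)
      (EkOfRecordT F N (TcOfRecord F N) (chiFixed7 F N ν) ε β P k)))

include hflow hind in
/-- **N09's THEOREM-3 MEMBER AT THE β RE-POINT OF RECORD, FROM [B11] THM 1 AND THE RECORD'S OWN PROVISO**: for a binding world whose run flow is `genFlow β P.g₀`
and whose `IndAss k` IS `IndAOfRecordT (TcOfRecord) (chiFixed7 ν) ε β …` at the record's own objects (node00-def-T's `Record10`: `indAss_stage10_iff`), if the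
(0.19) densities met along the run have continuous transforms of record at the steps `k < K` (`Provisos₁₀.contT`), then `smallCouplings → smallFieldInductive`
follows from (1.1) on the domains, `HRestrict` and (1.1)-uniqueness at the intermediate levels — [B11] Thm 1 at the record's objects (N07's content); NO composition
clause, NO invariance hypothesis, NO χ-locality hypothesis (MODULE 1's `thm3Member_of_indATPlug_of_steps` at §1∕§4).
[cite: Balaban1987RG1, Thm 3 p.264, (1.1)–(1.3) p.260, (0.13) p.254, p.263 and (2.16) p.269; Balaban1985Variational, Thm 1 p.279] -/
theorem thm3Member_of_indATPlug_TcOfRecord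
    (hex : ∀ k < P.K, HasContTransportAlongβ F N (TcOfRecord F N) ν P.K (genSeq β P.g0) k)
    (h11 : ∀ k, k ≤ P.K → ∀ V ∈ dom k, UkExists F N P.K k ε V ∧ UniqueUkOrbit F N P.K k ε V)
    (hres : ∀ k, k ≤ P.K → HRestrict F N ε P.K k (dom k))
    (huniq : ∀ k, k ≤ P.K → ∀ V ∈ dom k, ∀ j < k,
      UniqueUkOrbit F N P.K (j + 1) ε (Averaging.iter (avOfRecord F N P.K) (j + 1) (Uk F N P.K k ε V))) :
    (leavesP w P).smallCouplings → (leavesP w P).smallFieldInductive :=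
  thm3Member_of_indATPlug_of_steps (TcOfRecord F N) (chiFixed7 F N ν) ε β dom hflow hind
    (fun k _ => chiFixed7_extd_prefixOf ν P.K (genSeq β P.g0) k) (fun j _ => liftInvariant_chiFixed7 ν P.K _ j)
    (fun k hk => stepInvariant_TcOfRecord ν P.K (genSeq β P.g0) hk (hex k hk)) h11 hres huniq

include hflow hind in
/-- **N09 AT `(w, P)` AT THE β RE-POINT OF RECORD**: its own leaf `b12` + [B11] Thm 1 at the record's objects + the continuity proviso ⇒ `Dag.B12_main (leavesP w P)`.
[cite: Balaban1987RG1, Lemma 4 (3.53) p.280, Thm 3 p.264 and (1.1)–(1.3) p.260; Balaban1985Variational, Thm 1 p.279] -/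
theorem b12_main_of_indATPlug_of_leaf_TcOfRecord (h12 : (leavesP w P).b12)
    (hex : ∀ k < P.K, HasContTransportAlongβ F N (TcOfRecord F N) ν P.K (genSeq β P.g0) k)
    (h11 : ∀ k, k ≤ P.K → ∀ V ∈ dom k, UkExists F N P.K k ε V ∧ UniqueUkOrbit F N P.K k ε V)
    (hres : ∀ k, k ≤ P.K → HRestrict F N ε P.K k (dom k))
    (huniq : ∀ k, k ≤ P.K → ∀ V ∈ dom k, ∀ j < k,
      UniqueUkOrbit F N P.K (j + 1) ε (Averaging.iter (avOfRecord F N P.K) (j + 1) (Uk F N P.K k ε V))) :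
    Dag.B12_main (leavesP w P) :=
  b12_main_of_leaf_of_thm3Member h12 (thm3Member_of_indATPlug_TcOfRecord ν ε β dom hflow hind hex h11 hres huniq)

include hflow hind in
/-- θ-LEVEL FORM (node00-def-T's `Record10` proviso shape): with `Stage8Params.HasContTransportAlong θ` (`Provisos₁₀.contT`) for the numerics `ν = θ.ν`, the member at
`(w, P)` from (1.1) on the domains, `HRestrict` and intermediate uniqueness. [cite: Balaban1987RG1, Thm 3 p.264 and (1.1)–(1.3) p.260; Balaban1985Variational, Thm 1 p.279] -/
theorem thm3Member_of_indATPlug_TcOfRecord_of_hasContTransportAlong (θ : Stage8Params F N) (hν : ν = θ.ν) (hθ : θ.HasContTransportAlong)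
    (h11 : ∀ k, k ≤ P.K → ∀ V ∈ dom k, UkExists F N P.K k ε V ∧ UniqueUkOrbit F N P.K k ε V)
    (hres : ∀ k, k ≤ P.K → HRestrict F N ε P.K k (dom k))
    (huniq : ∀ k, k ≤ P.K → ∀ V ∈ dom k, ∀ j < k,
      UniqueUkOrbit F N P.K (j + 1) ε (Averaging.iter (avOfRecord F N P.K) (j + 1) (Uk F N P.K k ε V))) :
    (leavesP w P).smallCouplings → (leavesP w P).smallFieldInductive :=
  thm3Member_of_indATPlug_TcOfRecord ν ε β dom hflow hind (fun k hk => hν ▸ hθ P.K (genSeq β P.g0) k hk) h11 hres huniq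

end Plug

end Literature.MathematicalPhysics.QuantumFieldTheory.Balaban1983to89.B12NodeKnitContinuousTransport

end
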